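import Summits.ValiantsHypothesis.ValiantsHypothesis.Theorems.BarrierLeverAnchoredDoorHitsLowerPairsEvalDoor
import Mathlib.LinearAlgebra.Vandermonde
import Mathlib.Algebra.CharP.Lemmas
import Mathlib.Combinatorics.Colex
import Mathlib.Algebra.MvPolynomial.Funext
import Mathlib.Algebra.Order.Ring.GeomSum
import Mathlib.FieldTheory.Finite.Basic

/-!
# Route BarrierLever — support item `AnchoredDoorHitsLowerPairs` (stmt-ValiantsHypothesis-22510), line `anchored_peeling`:
# CONJECTURES GP AND E(cube) ARE THEOREMS — the Frobenius–Vandermonde argument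

This file PROVES the two conjecture nodes `Stmt.conjEvalGP` and `Stmt.conjEvalCube` of
`…AnchoredDoorHitsLowerPairsEvalDoor` (val-np-p1 g28, p712689): for every `D ⊆ Fin h`, every injective enumeration `u` of the
subsets of `D` (the full cube on `D` as row complex) and EVERY injective column family `w` with the same number `2^{|D|}` of faces,
some `θ : Fin h → Fin h → ℂ` makes the evaluation matrix `(∏_{b ∈ u i} Σ_{γ ∈ w j} θ_{bγ})_{i j}` nonsingular («multilinear
interpolation is unisolvent on the subset-sum nodes of any `2^n` distinct sets»).

PROOF (characteristic 2). Enumerate `D` by `e : D ≃ Fin n` and specialise `θ_{bγ} := z_γ ^ (2 ^ e b)` for integers `z_γ`. The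
determinant is then an integer polynomial `P(z)` in the `z_γ`. Reduce modulo 2: by Frobenius, `Σ_{γ ∈ W} z_γ^{2^k} ≡ (Σ_{γ∈W} z_γ)^{2^k}`,
so the `(i,j)` entry becomes `σ_j ^ m_i` with `σ_j = Σ_{γ ∈ w j} z_γ` and `m_i = Σ_{b ∈ u i} 2^{e b}`. As `u i` runs through the subsets of `D`,
`m_i` runs through `0, …, 2^n − 1` bijectively (binary expansion), so the reduced matrix is a row permutation of the Vandermonde matrix of the
`σ_j`, whose determinant `∏_{j<j'} (σ_{j'} − σ_j)` is nonzero in the domain `𝔽₂[z]` because the `w j` are distinct sets. Hence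
`P ≢ 0 (mod 2)`, so `P ≠ 0` over `ℤ`, so `P(z) ≠ 0` for some integer point `z` (ℤ is an infinite domain), and that point gives `θ`.

CONSEQUENCES (by the arrows already landed in `…EvalDoor`): `conjEvalCube_holds`, and `symbolicDet_ne_zero_cube` /
`symbolicDet_ne_zero_cube_swap` — EVERY lower pair one side of which is a full cube is hit by the anchored door 𝔄_s at every profile
`s ≥ 1` (e.g. cube_{2k} vs the Hamming ball B(2k+1,k), the Golay pair cube_11 vs B(23,3), cube_n vs tB(N,3) — formerly the first explicit
members of the `s = 2` residual), unconditionally and sorry-free.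

WHAT THIS IS NOT: the item needs all lower pairs; rows that are not a full cube give a generalized Vandermonde (a Schur polynomial at the
subset-sum linear forms, which can vanish mod 2 — e.g. three points versus an edge), so the evaluation door alone does not close the item.
Nothing here bears on crux 14610 or on `VP ≠ VNP`.
-/

set_option linter.dupNamespace false

namespace Summit.ValiantsHypothesis.ValiantsHypothesis.Theorems.BarrierLever.AnchoredPeeling

open Finset MvPolynomial

noncomputable section

namespace EvalGP

variable {h r : ℕ}

/-- In characteristic 2 the entry `(i, j)` collapses (Frobenius) to `σ_j ^ m_i` with `σ_j = Σ_{γ ∈ w j} g γ` and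
`m_i = Σ_{b ∈ u i} 2^{e b}`. -/
theorem frobEntry_charTwo {K : Type*} [CommRing K] [CharP K 2] (u w : Fin r → Finset (Fin h)) (e : Fin h → ℕ)
    (g : Fin h → K) (i j : Fin r) :
    (∏ b ∈ u i, ∑ γ ∈ w j, g γ ^ 2 ^ e b) = (∑ γ ∈ w j, g γ) ^ (∑ b ∈ u i, 2 ^ e b) := by
  haveI : Fact (Nat.Prime 2) := ⟨Nat.prime_two⟩
  rw [← Finset.prod_pow_eq_pow_sum]
  refine Finset.prod_congr rfl fun b _ => ?_
  rw [sum_pow_char_pow]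

/-- The coefficient of `X γ` in a sum of distinct variables `Σ_{γ' ∈ S} X γ'` is the indicator of `γ ∈ S`. -/
theorem coeff_single_sum_X {K : Type*} [CommRing K] (S : Finset (Fin h)) (γ : Fin h) :
    MvPolynomial.coeff (Finsupp.single γ 1) (∑ γ' ∈ S, (X γ' : MvPolynomial (Fin h) K)) = if γ ∈ S then 1 else 0 := by
  rw [MvPolynomial.coeff_sum]
  simp only [MvPolynomial.coeff_X, Finsupp.single_eq_single_iff, one_ne_zero, and_true, and_self, or_false]
  rw [Finset.sum_ite_eq' S γ (fun _ => (1 : K))]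

/-- Distinct sets have distinct subset-sum linear forms `Σ_{γ ∈ S} X γ` (over any nontrivial commutative ring). -/
theorem sum_X_injective {K : Type*} [CommRing K] [Nontrivial K] {S T : Finset (Fin h)}
    (hST : ∑ γ ∈ S, (X γ : MvPolynomial (Fin h) K) = ∑ γ ∈ T, (X γ : MvPolynomial (Fin h) K)) : S = T := by
  ext γ
  have := congr_arg (MvPolynomial.coeff (Finsupp.single γ 1)) hST
  rw [coeff_single_sum_X, coeff_single_sum_X] at this
  by_cases hS : γ ∈ S <;> by_cases hT : γ ∈ T <;> simp_all

/-- **Binary expansion on a labelled set.** If `e` is injective on `D`, the exponent map `S ↦ Σ_{b ∈ S} 2^{e b}` is injective on the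
subsets of `D`. -/
theorem twoPowSum_injOn {D S T : Finset (Fin h)} {e : Fin h → ℕ} (he : Set.InjOn e ↑D) (hS : S ⊆ D) (hT : T ⊆ D)
    (hsum : ∑ b ∈ S, 2 ^ e b = ∑ b ∈ T, 2 ^ e b) : S = T := by
  have hiS : Set.InjOn e ↑S := he.mono (by exact_mod_cast hS)
  have hiT : Set.InjOn e ↑T := he.mono (by exact_mod_cast hT)
  have h1 : ∑ b ∈ S, 2 ^ e b = ∑ k ∈ S.image e, 2 ^ k := (Finset.sum_image hiS).symm
  have h2 : ∑ b ∈ T, 2 ^ e b = ∑ k ∈ T.image e, 2 ^ k := (Finset.sum_image hiT).symm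
  rw [h1, h2] at hsum
  have himg : S.image e = T.image e := Finset.geomSum_injective (le_refl 2) hsum
  ext b
  constructor
  · intro hb
    have : e b ∈ T.image e := himg ▸ Finset.mem_image_of_mem e hb
    obtain ⟨b', hb', hbb'⟩ := Finset.mem_image.mp this
    have : b' = b := he (hT hb') (hS hb) hbb'
    exact this ▸ hb'
  · intro hb
    have : e b ∈ S.image e := himg.symm ▸ Finset.mem_image_of_mem e hb
    obtain ⟨b', hb', hbb'⟩ := Finset.mem_image.mp this
    have : b' = b := he (hS hb') (hT hb) hbb'
    exact this ▸ hb'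

/-- With labels `e b < n` on `D`, every subset of `D` has binary exponent `< 2^n`. -/
theorem twoPowSum_lt {D S : Finset (Fin h)} {e : Fin h → ℕ} {n : ℕ} (he : Set.InjOn e ↑D) (heD : ∀ b ∈ D, e b < n)
    (hS : S ⊆ D) : ∑ b ∈ S, 2 ^ e b < 2 ^ n := by
  have hiS : Set.InjOn e ↑S := he.mono (by exact_mod_cast hS)
  rw [← Finset.sum_image hiS]
  refine Nat.geomSum_lt (le_refl 2) fun k hk => ?_
  obtain ⟨b, hb, rfl⟩ := Finset.mem_image.mp hk
  exact heD b (hS hb)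

/-- If `u` enumerates exactly the subsets of `D` injectively, then `r = 2^{|D|}`. -/
theorem card_eq_two_pow {D : Finset (Fin h)} {u : Fin r → Finset (Fin h)} (hu : Function.Injective u)
    (hru : Set.range u = {S | S ⊆ D}) : r = 2 ^ D.card := by
  have himg : Finset.univ.image u = D.powerset := by
    ext S
    simp only [Finset.mem_image, Finset.mem_univ, true_and, Finset.mem_powerset]
    constructor
    · rintro ⟨i, rfl⟩
      have : u i ∈ Set.range u := ⟨i, rfl⟩
      rw [hru] at this; exact this
    · intro hS
      have : S ∈ Set.range u := by rw [hru]; exact hS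
      obtain ⟨i, hi⟩ := this; exact ⟨i, hi⟩
  have := congr_arg Finset.card himg
  rw [Finset.card_image_of_injective _ hu, Finset.card_univ, Fintype.card_fin, Finset.card_powerset] at this
  exact this

/-- A map of matrices along a ring homomorphism, for the Frobenius evaluation matrix `(∏_{b ∈ u i} Σ_{γ ∈ w j} g_γ^{2^{e b}})`. -/
theorem frobMatrix_map {K L : Type*} [CommRing K] [CommRing L] (f : K →+* L) (u w : Fin r → Finset (Fin h))
    (e : Fin h → ℕ) (g : Fin h → K) :
    (Matrix.of fun i j : Fin r => ∏ b ∈ u i, ∑ γ ∈ w j, g γ ^ 2 ^ e b).map f =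
      Matrix.of fun i j : Fin r => ∏ b ∈ u i, ∑ γ ∈ w j, f (g γ) ^ 2 ^ e b := by
  ext i j
  simp [map_prod, map_sum, map_pow]

/-- **The Frobenius–Vandermonde determinant (mod 2).** Over `𝔽₂[z]`: for cube rows on `D`, a labelling `e` injective on `D` with values
`< |D|`, and ANY injective column family `w`, the Frobenius evaluation matrix at `g = X` has nonzero determinant — it is a row permutation
of the Vandermonde matrix of the distinct linear forms `Σ_{γ ∈ w j} X_γ`. -/
theorem det_frob_zmod2_ne_zero (D : Finset (Fin h)) (u w : Fin r → Finset (Fin h)) (hu : Function.Injective u)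
    (hw : Function.Injective w) (hru : Set.range u = {S | S ⊆ D}) (e : Fin h → ℕ) (he : Set.InjOn e ↑D)
    (heD : ∀ b ∈ D, e b < D.card) :
    (Matrix.of fun i j : Fin r => ∏ b ∈ u i, ∑ γ ∈ w j, (X γ : MvPolynomial (Fin h) (ZMod 2)) ^ 2 ^ e b).det ≠ 0 := by
  classical
  set σ : Fin r → MvPolynomial (Fin h) (ZMod 2) := fun j => ∑ γ ∈ w j, X γ with hσ
  set m : Fin r → ℕ := fun i => ∑ b ∈ u i, 2 ^ e b with hm
  have hsub : ∀ i, u i ⊆ D := fun i => by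
    have : u i ∈ Set.range u := ⟨i, rfl⟩
    rw [hru] at this; exact this
  have hr : r = 2 ^ D.card := card_eq_two_pow hu hru
  -- the exponent map is a bijection of `Fin r`
  have hmlt : ∀ i, m i < r := fun i => hr ▸ twoPowSum_lt he heD (hsub i)
  let mFin : Fin r → Fin r := fun i => ⟨m i, hmlt i⟩
  have hminj : Function.Injective mFin := by
    intro i i' hii
    have hmm : m i = m i' := by simpa [mFin] using congr_arg Fin.val hii
    exact hu (twoPowSum_injOn he (hsub i) (hsub i') hmm)
  have hmbij : Function.Bijective mFin := Finite.injective_iff_bijective.mp hminj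
  let π : Equiv.Perm (Fin r) := Equiv.ofBijective mFin hmbij
  -- the matrix is a row permutation of the transposed Vandermonde matrix of `σ`
  have hM : (Matrix.of fun i j : Fin r => ∏ b ∈ u i, ∑ γ ∈ w j, (X γ : MvPolynomial (Fin h) (ZMod 2)) ^ 2 ^ e b) =
      ((Matrix.vandermonde σ).transpose).submatrix π id := by
    ext i j
    rw [Matrix.of_apply, frobEntry_charTwo]
    simp [Matrix.submatrix, Matrix.vandermonde_apply, π, mFin, hm, hσ]
  rw [hM, Matrix.det_permute, Matrix.det_transpose]
  refine mul_ne_zero ?_ ?_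
  · rcases Int.units_eq_one_or (Equiv.Perm.sign π) with h1 | h1 <;> simp [h1]
  · rw [Matrix.det_vandermonde_ne_zero_iff]
    intro j j' hjj
    exact hw (sum_X_injective hjj)

/-- **The integer Frobenius determinant is a nonzero polynomial** (its reduction mod 2 is the Vandermonde above). -/
theorem det_frob_int_ne_zero (D : Finset (Fin h)) (u w : Fin r → Finset (Fin h)) (hu : Function.Injective u)
    (hw : Function.Injective w) (hru : Set.range u = {S | S ⊆ D}) (e : Fin h → ℕ) (he : Set.InjOn e ↑D)
    (heD : ∀ b ∈ D, e b < D.card) :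
    (Matrix.of fun i j : Fin r => ∏ b ∈ u i, ∑ γ ∈ w j, (X γ : MvPolynomial (Fin h) ℤ) ^ 2 ^ e b).det ≠ 0 := by
  intro h0
  apply det_frob_zmod2_ne_zero D u w hu hw hru e he heD
  have := congr_arg (MvPolynomial.map (Int.castRingHom (ZMod 2))) h0
  rw [map_zero, RingHom.map_det, RingHom.mapMatrix_apply, frobMatrix_map] at this
  convert this using 3
  ext i j
  simp

/-- **Some INTEGER point makes the Frobenius evaluation matrix nonsingular** (ℤ is an infinite domain). -/
theorem exists_int_point (D : Finset (Fin h)) (u w : Fin r → Finset (Fin h)) (hu : Function.Injective u)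
    (hw : Function.Injective w) (hru : Set.range u = {S | S ⊆ D}) (e : Fin h → ℕ) (he : Set.InjOn e ↑D)
    (heD : ∀ b ∈ D, e b < D.card) :
    ∃ z : Fin h → ℤ, (Matrix.of fun i j : Fin r => ∏ b ∈ u i, ∑ γ ∈ w j, z γ ^ 2 ^ e b).det ≠ 0 := by
  by_contra hcon
  push Not at hcon
  apply det_frob_int_ne_zero D u w hu hw hru e he heD
  apply MvPolynomial.funext
  intro z
  rw [map_zero, RingHom.map_det, RingHom.mapMatrix_apply, frobMatrix_map]
  have hz := hcon z
  convert hz using 3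
  ext i j
  simp

/-- **A labelling of `D` by `0, …, |D| − 1` exists** (from `Finset.equivFin`). -/
theorem exists_labelling (D : Finset (Fin h)) : ∃ e : Fin h → ℕ, Set.InjOn e ↑D ∧ ∀ b ∈ D, e b < D.card := by
  classical
  refine ⟨fun b => if hb : b ∈ D then (D.equivFin ⟨b, hb⟩ : ℕ) else 0, ?_, ?_⟩
  · intro b hb b' hb' hbb
    have hb₀ : b ∈ D := by exact_mod_cast hb
    have hb₀' : b' ∈ D := by exact_mod_cast hb'
    simp only [hb₀, hb₀', dif_pos] at hbb
    have : D.equivFin ⟨b, hb₀⟩ = D.equivFin ⟨b', hb₀'⟩ := Fin.ext hbb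
    exact congr_arg Subtype.val (D.equivFin.injective this)
  · intro b hb
    simp only [hb, dif_pos]
    exact (D.equivFin ⟨b, hb⟩).isLt

end EvalGP

open EvalGP in
/-- **THEOREM (was CONJECTURE GP, `Stmt.conjEvalGP` of `…EvalDoor`, val-np-p1 g28).** For every `D ⊆ Fin h`, every injective
enumeration `u` of the subsets of `D` and every injective column family `w` of the same size, some `θ` makes the evaluation matrix
`(∏_{b ∈ u i} Σ_{γ ∈ w j} θ_{bγ})` nonsingular: the multilinear Veronese of the subset sums of `2^n` DISTINCT sets is in linearly general
position for generic generating vectors. Witness: `θ_{bγ} = z_γ ^ 2^{e b}` for a suitable integer point `z` and a labelling `e` of `D` by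
`0 … |D| − 1` (the Frobenius–Vandermonde argument mod 2 of the module docstring). -/
theorem conjEvalGP_holds : Stmt.conjEvalGP := by
  intro h r D u w hu hw hru
  obtain ⟨e, he, heD⟩ := exists_labelling D
  obtain ⟨z, hz⟩ := exists_int_point D u w hu hw hru e he heD
  refine ⟨fun b γ => ((z γ : ℂ)) ^ 2 ^ e b, ?_⟩
  have hmap : (Matrix.of fun i j : Fin r => ∏ b ∈ u i, ∑ γ ∈ w j, ((z γ : ℂ)) ^ 2 ^ e b) =
      (Matrix.of fun i j : Fin r => ∏ b ∈ u i, ∑ γ ∈ w j, z γ ^ 2 ^ e b).map (Int.castRingHom ℂ) := by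
    rw [frobMatrix_map]; rfl
  rw [hmap, ← RingHom.mapMatrix_apply, ← RingHom.map_det]
  exact fun h0 => hz ((Int.castRingHom ℂ).injective_int (h0.trans (map_zero _).symm))

/-- **THEOREM (was CONJECTURE E(cube), `Stmt.conjEvalCube`): multilinear interpolation is unisolvent on the subset-sum nodes of every
down-closed family of `2^n` sets** (the lower-set hypothesis is not even needed: `conjEvalGP_holds`). -/
theorem conjEvalCube_holds : Stmt.conjEvalCube := conjEvalCube_of_GP conjEvalGP_holds

/-- **Every cube-row lower pair is hit at every profile `s ≥ 1`, unconditionally:** if `u` enumerates exactly the subsets of some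
`D ⊆ Fin h` and `w` is any injective enumeration of a lower column family of the same size `2^{|D|}`, then `symbolicDet s h r u w ≠ 0`.
(CubeBall `2^[2k]` vs `B(2k+1, k)` for every `k`, the Golay pair, cube_n vs tB(N,3) for all `n`, cube_n vs `K_N + T`, … — by
`symbolicDet_ne_zero_cube_of_conjEvalCube` and `conjEvalCube_holds`.) -/
theorem symbolicDet_ne_zero_cube {s h r : ℕ} (hs : 1 ≤ s) (D : Finset (Fin h)) (u w : Fin r → Finset (Fin h))
    (hu : Function.Injective u) (hw : Function.Injective w) (hru : Set.range u = {S | S ⊆ D})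
    (hlw : IsLowerSet (Set.range w)) : symbolicDet s h r u w ≠ 0 :=
  symbolicDet_ne_zero_cube_of_conjEvalCube conjEvalCube_holds hs D u w hu hw hru hlw

/-- **Cube COLUMNS:** if the column family is a full cube on some `D` and the row family is any injective lower family of the same size,
the pair is hit at every profile `s ≥ 1` (`symbolicDet_ne_zero_swap`). -/
theorem symbolicDet_ne_zero_cube_swap {s h r : ℕ} (hs : 1 ≤ s) (D : Finset (Fin h)) (u w : Fin r → Finset (Fin h))
    (hu : Function.Injective u) (hw : Function.Injective w) (hlu : IsLowerSet (Set.range u))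
    (hrw : Set.range w = {S | S ⊆ D}) : symbolicDet s h r u w ≠ 0 :=
  symbolicDet_ne_zero_swap s h r u w (symbolicDet_ne_zero_cube hs D w u hw hu hrw hlu)

/-- **Complex form:** every cube-row lower pair carries a member of the anchored door 𝔄_s with nonzero partition minor. -/
theorem anchoredHit_cube {s h r : ℕ} (hs : 1 ≤ s) (D : Finset (Fin h)) (u w : Fin r → Finset (Fin h))
    (hu : Function.Injective u) (hw : Function.Injective w) (hru : Set.range u = {S | S ⊆ D})
    (hlw : IsLowerSet (Set.range w)) : AnchoredHit s h r u w :=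
  stub_genericPoint s h r u w (symbolicDet_ne_zero_cube hs D u w hu hw hru hlw)

end

end Summit.ValiantsHypothesis.ValiantsHypothesis.Theorems.BarrierLever.AnchoredPeeling
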